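import Summits.BirchSwinnertonDyer.BirchSwinnertonDyer.Theses.CumulativeHeegnerLeopoldt
import Summits.BirchSwinnertonDyer.BirchSwinnertonDyer.Theorems.CumulativeHeegnerLeopoldtCumulativeHeegnerInclusionAtThreeB1OfPrint
import Summits.BirchSwinnertonDyer.BirchSwinnertonDyer.Theorems.CumulativeHeegnerLeopoldtCumulativeHeegnerInclusionAtThreeLineDeterminantAtThree
import Summits.BirchSwinnertonDyer.BirchSwinnertonDyer.Theorems.CumulativeHeegnerLeopoldtCumulativeHeegnerInclusionAtThreeBadPlacesSplitFinite
import Summits.BirchSwinnertonDyer.BirchSwinnertonDyer.Theorems.UniversalToricDescentAcDualMuZeroCriterion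
import Summits.BirchSwinnertonDyer.BirchSwinnertonDyer.Theorems.CumulativeHeegnerLeopoldtCumulativeHeegnerInclusionAtThreeUnrSeriesTemperedDomination
import HarnessLib

/-!
# Crux K1 `CumulativeHeegnerInclusionAtThree` (stmt-BirchSwinnertonDyer-24198), line `birth`: K1 from PRINT and
# the TEMPERED-VALUES form A♮ of stub A — `K1 ⟸ P ∧ A♮`, and `A ⟹ A♮` (so lining crux 26896 as A♮ loses nothing)

Lead prover bsd-line-chl-k1-p1 g4 (`--supports stmt-BirchSwinnertonDyer-24198`). Consumer of
`…UnrSeriesTemperedDomination` (this lineage, p624927) at the crux frame.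

Stub A of line `birth` (= crux stmt-BirchSwinnertonDyer-26896 `TemperedHeegnerInclusionAtThree`, research) is stated in
IDEAL currency: `∃ μ, span{3^μ · L} ≤ (Ch_Λ X_{∅,0}(𝔭′)).map toUnr`. A Kolyvagin-system argument with the TEMPERED
cumulative class — the only Λ-adic Heegner object available at the trace-zero prime `3` (`…TraceZeroHeegnerModule`,
p621811/p622174) — delivers instead, at the same frame, the TEMPERED-VALUES statement

  A♮ : for every generator `g` of `(Ch_Λ X_{∅,0}(𝔭′)).map toUnr` and every radius `ρ < 1` there are a finite
       `F_ρ ⊆ ℂ_3` and `C_ρ` with `‖L(x)‖ ≤ C_ρ · ‖g(x)‖` for all `‖x‖ ≤ ρ`, `x ∉ F_ρ`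

(constants allowed to blow up toward the rim). This file records, BY NAME against the route decls:

* `cumulativeHeegnerInclusionAtThree_of_print_of_temperedDomination`: **P → A♮ → K1** — print (stub P =
  `ResidualSelmerPrintedInputAtThree`, via the landed B1-from-print theorem p613183 with its two inputs p614633/p613929 — the content of the
  26898 closer p616187 — and UTD's Greenberg criterion) makes the
  image of the characteristic ideal principal with a generator having a norm-one coefficient; tempered domination
  by that generator plus saturation at `3` is K1's inclusion
  (`…UnrSeriesTemperedDomination.span_le_of_norm_value_le_on_closedBalls_of_norm_coeff_eq_one`).
* `temperedDomination_of_temperedHeegnerInclusionAtThree`: **A → A♮** unconditionally (an ideal inclusion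
  `span{3^μ L} ≤ (g)` is uniform domination with constant `3^μ`, width seat's `norm_value_le_of_C_pow_mul_mem_span`).
  With the first theorem and the trivial K1 → A (take `μ = 0`): modulo print, A ⟺ A♮ ⟺ K1 — the tempered-values
  form is an honest restatement of crux 26896 for a line built on a tempered class, not a weakening and not a
  strengthening.

HONEST FRAMING: theorems only; A♮ is a displayed hypothesis (no definition is introduced); nothing about the
existence of a tempered Kolyvagin system at additive `3` is asserted — that is crux 26896's research content.
No named fact, no `sorry`. BSD is not proved by any of this; no summit statement is proved by this seat.
-/

set_option linter.dupNamespace false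
set_option autoImplicit false

noncomputable section

open scoped Classical

namespace Summit.BirchSwinnertonDyer.BirchSwinnertonDyer.Theorems.CumulativeHeegnerInclusionAtThreeOfTemperedDomination

open Literature.NumberTheory.EllipticCurves NumberField IsDedekindDomain Field
  Summit.BirchSwinnertonDyer.Rank1Residual.X11b Summit.BirchSwinnertonDyer.Rank1Residual.X11b.AcSelmer
  Summit.BirchSwinnertonDyer.BirchSwinnertonDyer.Theorems.CumulativeHeegnerInclusionAtThreeUnrSeriesTemperedDomination
  Summit.BirchSwinnertonDyer.BirchSwinnertonDyer.Theorems.CumulativeHeegnerInclusionAtThreeUnrSeriesDomination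

/-- **K1 ⟸ PRINT ∧ A♮ (tempered values).** If the print input P (`ResidualSelmerPrintedInputAtThree` = CGLS22
Prop. 14 by name) holds and, at every frame of crux K1, the BDP function `L` is TEMPEREDLY dominated by every
generator `g` of `(Ch_Λ X_{∅,0}(𝔭′)).map toUnr` (constants `C_ρ` and finite exceptional sets `F_ρ` on each closed
ball `‖x‖ ≤ ρ < 1`), then the route crux `CumulativeHeegnerInclusionAtThree` holds. Proof: P ⟹ B1 (`…B1OfPrint.stub_residualSelmerFinite_of_print`
with p614633/p613929, = the 26898 closer) ⟹ the image ideal is `span{g}` with `‖g_n‖ = 1` (UTD Greenberg criterion) ⟹ K1's inclusion by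
`span_le_of_norm_value_le_on_closedBalls_of_norm_coeff_eq_one`. [cite: Washington1997, §7.1 Thm. 7.3] -/
theorem cumulativeHeegnerInclusionAtThree_of_print_of_temperedDomination
    (hP : Summit.BirchSwinnertonDyer.BirchSwinnertonDyer.Theses.CumulativeHeegnerLeopoldt.ResidualSelmerPrintedInputAtThree)
    (hA : ∀ (W : WeierstrassCurve ℚ) [W.IsElliptic] [W.IsGloballyMinimal] (N : ℕ) [NeZero N] (K : Type) [Field K] [NumberField K] (Dt : Literature.NumberTheory.EllipticCurves.ModularForms.ModularParametrizationData W N), Summit.BirchSwinnertonDyer.Rank1Residual.Additive.ClassO6 W 3 → Literature.NumberTheory.EllipticCurves.Rank1Residual.Red W 3 → (∃ Φ : AddSubgroup (WeierstrassCurve.geomTorsion W ((3 : ℕ) : ℤ)), Literature.NumberTheory.EllipticCurves.Rank1Residual.IsRationalLine W 3 Φ ∧ ∀ (v : IsDedekindDomain.HeightOneSpectrum (NumberField.RingOfIntegers ℚ)), ((3 : ℕ) : NumberField.RingOfIntegers ℚ) ∈ v.asIdeal → ∀ 𝔓 ∈ v.primesAbove, ¬ (∀ g ∈ 𝔓.decompositionSubgroup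 (Field.absoluteGaloisGroup ℚ), ∀ P ∈ Φ, g • P = P) ∧ ¬ (∀ g ∈ 𝔓.decompositionSubgroup (Field.absoluteGaloisGroup ℚ), ∀ P : WeierstrassCurve.geomTorsion W ((3 : ℕ) : ℤ), g • P - P ∈ Φ)) → W.analyticRank = 1 → W.conductorNorm ℤ = N → Literature.NumberTheory.EllipticCurves.IsImaginaryQuadratic K → Literature.NumberTheory.EllipticCurves.SatisfiesHeegnerHypothesis N K → ∀ (κ : Literature.NumberTheory.EllipticCurves.ZpExtension K 3), κ.IsAnticyclotomic → ∀ (γ : Field.absoluteGaloisGroup K) [Fact (κ.IsTopGenerator γ)] (𝔭 : IsDedekindDomain.HeightOneSpectrum (NumberField.RingOfIntegers K)), ((3 : ℕ) : NumberField.RingOfIntegers K) ∈ 𝔭.asIdeal → 𝔭.asIdeal.ramificationIdx (NumberField.RingOfIntegers ℚ) = 1 → 𝔭.asIdeal.inertiaDeg (NumberField.RingOfIntegers ℚ) = 1 → ∀ (𝔭' : IsDedekindDomain.HeightOneSpectrum (NumberField.RingOfIntegers K)), ((3 : ℕ) : NumberField.RingOfIntegers K) ∈ 𝔭'.asIdeal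 → 𝔭' ≠ 𝔭 → ∀ (ι' : PadicAlgCl 3 ≃+* ℂ), Summit.BirchSwinnertonDyer.BirchSwinnertonDyer.Theorems.SchneiderFree.BranchInducesPrime 3 ι' 𝔭 → ∀ (ΩK : ℂ) (Ωp : ℂ_[3]) (L : Literature.NumberTheory.EllipticCurves.UnrSeries 3), ΩK ≠ 0 → Ωp ≠ 0 → Literature.NumberTheory.EllipticCurves.IsBDPLFunction ι' 𝔭 κ γ Dt.f ΩK Ωp L → ∀ (g : Literature.NumberTheory.EllipticCurves.UnrSeries 3), (Summit.BirchSwinnertonDyer.Rank1Residual.X11b.AcSelmer.XAc.charIdeal (W.baseChange K) 3 κ 𝔭' ∅ γ).map (PowerSeries.map (Summit.BirchSwinnertonDyer.Rank1Residual.X11b.Halves.toUnr 3)) = Ideal.span {g} → ∀ ρ : ℝ, ρ < 1 → ∃ (F : Set ℂ_[3]) (C : ℝ), F.Finite ∧ ∀ x : ℂ_[3], x ∉ F → ‖x‖ ≤ ρ → ∀ u v : ℂ_[3], g.HasValueAt x u → L.HasValueAt x v → ‖v‖ ≤ C * ‖u‖) :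
    Summit.BirchSwinnertonDyer.BirchSwinnertonDyer.Theses.CumulativeHeegnerLeopoldt.CumulativeHeegnerInclusionAtThree := by
  intro W _ _ N _ K _ _ Dt hO6 hRed hcell hr hN hK hHg κ hκ γ _ 𝔭 h𝔭 he hf 𝔭' h𝔭' hne ι' hι ΩK Ωp L hΩK hΩp hBDP
  haveI : (W.baseChange K).IsElliptic := inferInstanceAs (W.map (algebraMap ℚ K)).IsElliptic
  -- B1 from print (the three inputs of the landed 26898 closer, route-independent modules)
  have hfin :=
    Summit.BirchSwinnertonDyer.BirchSwinnertonDyer.Theorems.CumulativeHeegnerInclusionAtThreeB1OfPrint.stub_residualSelmerFinite_of_print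
      hP
      Summit.BirchSwinnertonDyer.BirchSwinnertonDyer.Theorems.CumulativeHeegnerInclusionAtThreeLineDet.stub_lineDeterminantAtThree
      Summit.BirchSwinnertonDyer.BirchSwinnertonDyer.Theorems.CumulativeHeegnerInclusionAtThreeBadPlaces.stub_badPlacesSplitFinite
      W N K hO6 hRed hcell hN hK hHg κ hκ 𝔭' h𝔭'
  obtain ⟨_, g, hg, n, hn⟩ :=
    Summit.BirchSwinnertonDyer.BirchSwinnertonDyer.Theorems.UniversalToricDescentAcDualMuZero.isTorsion_and_exists_generator_of_finite_pTorsion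
      (W.baseChange K) 3 κ 𝔭' ∅ γ Set.finite_empty hfin
  have hdom := hA W N K Dt hO6 hRed hcell hr hN hK hHg κ hκ γ 𝔭 h𝔭 he hf 𝔭' h𝔭' hne ι' hι ΩK Ωp L hΩK hΩp hBDP g hg
  exact span_le_of_norm_value_le_on_closedBalls_of_norm_coeff_eq_one hg hn hdom

/-- **A ⟹ A♮**: the ideal-currency stub A (= crux stmt-26896 `TemperedHeegnerInclusionAtThree` BY NAME) implies its
tempered-values form — `span{3^μ · L} ≤ (g)` gives the UNIFORM domination `‖L(x)‖ ≤ 3^μ · ‖g(x)‖` on the whole open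
disc (width seat's `norm_value_le_of_C_pow_mul_mem_span`), a fortiori the tempered one (`F_ρ = ∅`, `C_ρ = 3^μ`).
So A♮ is not stronger than A; with `cumulativeHeegnerInclusionAtThree_of_print_of_temperedDomination` and K1 ⟹ A
(`μ = 0`) the three statements agree modulo print. [cite: Washington1997, §7.1] -/
theorem temperedDomination_of_temperedHeegnerInclusionAtThree
    (hA : Summit.BirchSwinnertonDyer.BirchSwinnertonDyer.Theses.CumulativeHeegnerLeopoldt.TemperedHeegnerInclusionAtThree) :
    ∀ (W : WeierstrassCurve ℚ) [W.IsElliptic] [W.IsGloballyMinimal] (N : ℕ) [NeZero N] (K : Type) [Field K] [NumberField K] (Dt : Literature.NumberTheory.EllipticCurves.ModularForms.ModularParametrizationData W N), Summit.BirchSwinnertonDyer.Rank1Residual.Additive.ClassO6 W 3 → Literature.NumberTheory.EllipticCurves.Rank1Residual.Red W 3 → (∃ Φ : AddSubgroup (WeierstrassCurve.geomTorsion W ((3 : ℕ) : ℤ)), Literature.NumberTheory.EllipticCurves.Rank1Residual.IsRationalLine W 3 Φ ∧ ∀ (v : IsDedekindDomain.HeightOneSpectrum (NumberField.RingOfIntegers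 ℚ)), ((3 : ℕ) : NumberField.RingOfIntegers ℚ) ∈ v.asIdeal → ∀ 𝔓 ∈ v.primesAbove, ¬ (∀ g ∈ 𝔓.decompositionSubgroup (Field.absoluteGaloisGroup ℚ), ∀ P ∈ Φ, g • P = P) ∧ ¬ (∀ g ∈ 𝔓.decompositionSubgroup (Field.absoluteGaloisGroup ℚ), ∀ P : WeierstrassCurve.geomTorsion W ((3 : ℕ) : ℤ), g • P - P ∈ Φ)) → W.analyticRank = 1 → W.conductorNorm ℤ = N → Literature.NumberTheory.EllipticCurves.IsImaginaryQuadratic K → Literature.NumberTheory.EllipticCurves.SatisfiesHeegnerHypothesis N K → ∀ (κ : Literature.NumberTheory.EllipticCurves.ZpExtension K 3), κ.IsAnticyclotomic → ∀ (γ : Field.absoluteGaloisGroup K) [Fact (κ.IsTopGenerator γ)] (𝔭 : IsDedekindDomain.HeightOneSpectrum (NumberField.RingOfIntegers K)), ((3 : ℕ) : NumberField.RingOfIntegers K) ∈ 𝔭.asIdeal → 𝔭.asIdeal.ramificationIdx (NumberField.RingOfIntegers ℚ) = 1 → 𝔭.asIdeal.inertiaDeg (NumberField.RingOfIntegers ℚ)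 = 1 → ∀ (𝔭' : IsDedekindDomain.HeightOneSpectrum (NumberField.RingOfIntegers K)), ((3 : ℕ) : NumberField.RingOfIntegers K) ∈ 𝔭'.asIdeal → 𝔭' ≠ 𝔭 → ∀ (ι' : PadicAlgCl 3 ≃+* ℂ), Summit.BirchSwinnertonDyer.BirchSwinnertonDyer.Theorems.SchneiderFree.BranchInducesPrime 3 ι' 𝔭 → ∀ (ΩK : ℂ) (Ωp : ℂ_[3]) (L : Literature.NumberTheory.EllipticCurves.UnrSeries 3), ΩK ≠ 0 → Ωp ≠ 0 → Literature.NumberTheory.EllipticCurves.IsBDPLFunction ι' 𝔭 κ γ Dt.f ΩK Ωp L → ∀ (g : Literature.NumberTheory.EllipticCurves.UnrSeries 3), (Summit.BirchSwinnertonDyer.Rank1Residual.X11b.AcSelmer.XAc.charIdeal (W.baseChange K) 3 κ 𝔭' ∅ γ).map (PowerSeries.map (Summit.BirchSwinnertonDyer.Rank1Residual.X11b.Halves.toUnr 3)) = Ideal.span {g} → ∀ ρ : ℝ, ρ < 1 → ∃ (F : Set ℂ_[3]) (C : ℝ), F.Finite ∧ ∀ x : ℂ_[3], x ∉ F → ‖x‖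 ≤ ρ → ∀ u v : ℂ_[3], g.HasValueAt x u → L.HasValueAt x v → ‖v‖ ≤ C * ‖u‖ := by
  intro W _ _ N _ K _ _ Dt hO6 hRed hcell hr hN hK hHg κ hκ γ _ 𝔭 h𝔭 he hf 𝔭' h𝔭' hne ι' hι ΩK Ωp L hΩK hΩp hBDP
    g hg ρ hρ
  obtain ⟨μ, hμ⟩ := hA W N K Dt hO6 hRed hcell hr hN hK hHg κ hκ γ 𝔭 h𝔭 he hf 𝔭' h𝔭' hne ι' hι ΩK Ωp L hΩK
    hΩp hBDP
  rw [hg, Ideal.span_singleton_le_iff_mem] at hμ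
  have hμ' : PowerSeries.C (((3 : ℕ) : unrIntegers 3) ^ μ) * L ∈ Ideal.span {g} := by
    have heq : ((3 : ℕ) : UnrSeries 3) ^ μ * L = PowerSeries.C (((3 : ℕ) : unrIntegers 3) ^ μ) * L := by
      rw [map_pow, map_natCast]
    rw [← heq]
    exact_mod_cast hμ
  refine ⟨∅, (3 : ℝ) ^ μ, Set.finite_empty, fun x _ hx u v hu hv ↦ ?_⟩
  exact_mod_cast norm_value_le_of_C_pow_mul_mem_span (p := 3) hμ' (lt_of_le_of_lt hx hρ) hu hv

end Summit.BirchSwinnertonDyer.BirchSwinnertonDyer.Theorems.CumulativeHeegnerInclusionAtThreeOfTemperedDomination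

end
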